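import Literature.MathematicalPhysics.QuantumLattice.AndersonTowerOfStates
import Literature.MathematicalPhysics.QuantumLattice.KomaTasakiSSBTowerProofs
import HarnessLib

/-!
# The Anderson tower of states, unconditionally: KT94 Corollary 2.11 for the Heisenberg antiferromagnet
# and hard-core lattice bosons with Theorem 2.4 discharged

Companion of `AndersonTowerOfStates.lean`: that file proves Koma–Tasaki 1994 Corollary 2.11 BY NAME for the spin-`S`
Heisenberg antiferromagnet (§3.2) and the half-filled hard-core lattice Bose gas (§3.3) conditionally on the tree's named
fact `KomaTasaki.theorem_2_4` (KT94 Theorem 2.4).  The fact is PROVED in the tree — `KomaTasaki.theorem_2_4_holds`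
(`KomaTasakiSSBTowerProofs.lean`, §5 of the paper) — and this file feeds it in, giving the unconditional statements
(T. Koma, H. Tasaki, J. Stat. Phys. **76** (1994) 745–803, Corollary 2.11: "`E_Λ^{(M)} - E_Λ^{(0)} ≤ c₃M²/N` … there
exist ever increasing numbers of low-lying eigenstates whose excitation energies are bounded from above by a constant
times `N⁻¹`"; §3.2 "Assuming the existence of the Néel order, we can apply our low-lying states theorems"; here the Néel
/ off-diagonal order is the tree's reflection-positivity theorem, so nothing is assumed).  No new statements beyond the
specialisation `h24 := theorem_2_4_holds`; 0 named facts, 0 sorry.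

## References
* [KomaTasaki1994] T. Koma, H. Tasaki, J. Stat. Phys. **76** (1994) 745–803, Theorem 2.4, Corollary 2.11, §3.2, §3.3.
* [Tasaki2019Tower] H. Tasaki, J. Stat. Phys. **174** (2019) 735–761, Theorem 3.1, Corollary 3.2.
-/

noncomputable section

open Matrix Finset Filter Topology
open Literature.MathematicalPhysics.QuantumLattice Literature.Probability.LatticeModels

namespace Literature.MathematicalPhysics.QuantumLattice

namespace XXZKT

variable {d : ℕ}

/-- **THE ANDERSON TOWER OF THE HEISENBERG ANTIFERROMAGNET, UNCONDITIONALLY** (KT94 Corollary 2.11 + §3.2 with Theorem 2.4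
= `KomaTasaki.theorem_2_4_holds` and Néel order = the tree's reflection-positivity theorem): `S = n/2`, `J > 0`, `d ≥ 2`,
`(d, S) ≠ (2, ½)`; `∃ c₂ > 0, c₃, ∀ᶠ k, ∀ M ≠ 0, M² ≤ c₂N_k →` the sector `Sᶻ_tot = M` is nonempty and
`E_k(M) - E_k(0) ≤ c₃M²/N_k` on `(ℤ/(2k+2)ℤ)^d`. [cite: KomaTasaki1994, Corollary 2.11, §3.2] [cite: Tasaki2019Tower, Corollary 3.2] -/
theorem heisenbergAF_andersonTower_holds (hd : 2 ≤ d) {n : ℕ} (hn : 1 ≤ n) (hdn : ¬ (d = 2 ∧ n = 1)) {J : ℝ} (hJ : 0 < J) :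
    ∃ c₂ c₃ : ℝ, 0 < c₂ ∧ ∀ᶠ k : ℕ in atTop, ∀ M : ℤ, M ≠ 0 →
      (M : ℝ) ^ 2 ≤ c₂ * Fintype.card (TorusSite d (2 * k + 2)) →
        spinZSector (Λ := TorusSite d (2 * k + 2)) n (M : ℝ) ≠ ⊥ ∧
        lowestEnergyInSector n (xxzHamiltonian n (torusGraph d (2 * k + 2)) J 1) M -
            (xxzHamiltonian n (torusGraph d (2 * k + 2)) J 1).groundEnergy ≤
          c₃ * (M : ℝ) ^ 2 / Fintype.card (TorusSite d (2 * k + 2)) :=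
  heisenbergAF_andersonTower KomaTasaki.theorem_2_4_holds hd hn hdn hJ

/-- Fixed `M`, unconditionally: for every `M ≠ 0`, eventually `E_k(M) - E_k(0) ≤ c₃M²/N_k`.
[cite: KomaTasaki1994, Corollary 2.11, §3.2] -/
theorem heisenbergAF_andersonTower_fixed_holds (hd : 2 ≤ d) {n : ℕ} (hn : 1 ≤ n) (hdn : ¬ (d = 2 ∧ n = 1))
    {J : ℝ} (hJ : 0 < J) :
    ∃ c₃ : ℝ, ∀ M : ℤ, M ≠ 0 → ∀ᶠ k : ℕ in atTop,
      spinZSector (Λ := TorusSite d (2 * k + 2)) n (M : ℝ) ≠ ⊥ ∧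
        lowestEnergyInSector n (xxzHamiltonian n (torusGraph d (2 * k + 2)) J 1) M -
            (xxzHamiltonian n (torusGraph d (2 * k + 2)) J 1).groundEnergy ≤
          c₃ * (M : ℝ) ^ 2 / Fintype.card (TorusSite d (2 * k + 2)) :=
  heisenbergAF_andersonTower_fixed KomaTasaki.theorem_2_4_holds hd hn hdn hJ

/-- The low-lying EIGENSTATES of the Heisenberg antiferromagnet, unconditionally (KT94 Corollary 2.11 as printed).
[cite: KomaTasaki1994, Corollary 2.11, §3.2] -/
theorem heisenbergAF_andersonTower_eigenstates_holds (hd : 2 ≤ d) {n : ℕ} (hn : 1 ≤ n) (hdn : ¬ (d = 2 ∧ n = 1))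
    {J : ℝ} (hJ : 0 < J) :
    ∃ c₂ c₃ : ℝ, 0 < c₂ ∧ ∀ᶠ k : ℕ in atTop, ∀ M : ℤ, M ≠ 0 →
      (M : ℝ) ^ 2 ≤ c₂ * Fintype.card (TorusSite d (2 * k + 2)) →
        ∃ (Ψ : TensorIndex (TorusSite d (2 * k + 2)) (n + 1) → ℂ) (E : ℝ), star Ψ ⬝ᵥ Ψ = 1 ∧
          totalSpin n 2 *ᵥ Ψ = (M : ℂ) • Ψ ∧ xxzHamiltonian n (torusGraph d (2 * k + 2)) J 1 *ᵥ Ψ = (E : ℂ) • Ψ ∧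
          (∀ Φ₀ : TensorIndex (TorusSite d (2 * k + 2)) (n + 1) → ℂ,
            xxzHamiltonian n (torusGraph d (2 * k + 2)) J 1 *ᵥ Φ₀ =
              ((xxzHamiltonian n (torusGraph d (2 * k + 2)) J 1).groundEnergy : ℂ) • Φ₀ → star Φ₀ ⬝ᵥ Ψ = 0) ∧
          E - (xxzHamiltonian n (torusGraph d (2 * k + 2)) J 1).groundEnergy ≤
            c₃ * (M : ℝ) ^ 2 / Fintype.card (TorusSite d (2 * k + 2)) :=
  heisenbergAF_andersonTower_eigenstates KomaTasaki.theorem_2_4_holds hd hn hdn hJ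

/-- **THE TOWER OF HARD-CORE LATTICE BOSONS AT HALF FILLING, UNCONDITIONALLY** (KT94 §3.3 / Corollary 2.11): `d ≥ 2`,
`H_j = xxzHamiltonian 1 (torusGraph d (2(j+1))) (-1) 0`; the tower in the particle-number sectors `N_j/2 + M`.
[cite: KomaTasaki1994, Corollary 2.11, §3.3] [cite: Tasaki2019Tower, §3.2] -/
theorem hardCoreBoson_andersonTower_holds (hd : 2 ≤ d) :
    ∃ c₂ c₃ : ℝ, 0 < c₂ ∧ ∀ᶠ j : ℕ in atTop, ∀ M : ℤ, M ≠ 0 →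
      (M : ℝ) ^ 2 ≤ c₂ * Fintype.card (TorusSite d (2 * (j + 1))) →
        spinZSector (Λ := TorusSite d (2 * (j + 1))) 1 (M : ℝ) ≠ ⊥ ∧
        lowestEnergyInSector 1 (xxzHamiltonian 1 (torusGraph d (2 * (j + 1))) (-1) 0) M -
            (xxzHamiltonian 1 (torusGraph d (2 * (j + 1))) (-1) 0).groundEnergy ≤
          c₃ * (M : ℝ) ^ 2 / Fintype.card (TorusSite d (2 * (j + 1))) :=
  hardCoreBoson_andersonTower KomaTasaki.theorem_2_4_holds hd

/-- The low-lying eigenstates of the Bose gas with exactly `N/2 + M` particles, unconditionally.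
[cite: KomaTasaki1994, Corollary 2.11, §3.3] -/
theorem hardCoreBoson_andersonTower_eigenstates_holds (hd : 2 ≤ d) :
    ∃ c₂ c₃ : ℝ, 0 < c₂ ∧ ∀ᶠ j : ℕ in atTop, ∀ M : ℤ, M ≠ 0 →
      (M : ℝ) ^ 2 ≤ c₂ * Fintype.card (TorusSite d (2 * (j + 1))) →
        ∃ (Ψ : TensorIndex (TorusSite d (2 * (j + 1))) 2 → ℂ) (E : ℝ), star Ψ ⬝ᵥ Ψ = 1 ∧
          (∑ x : TorusSite d (2 * (j + 1)), HardCoreBoson.num x) *ᵥ Ψ =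
            ((Fintype.card (TorusSite d (2 * (j + 1))) : ℂ) / 2 + M) • Ψ ∧
          xxzHamiltonian 1 (torusGraph d (2 * (j + 1))) (-1) 0 *ᵥ Ψ = (E : ℂ) • Ψ ∧
          (∀ Φ₀ : TensorIndex (TorusSite d (2 * (j + 1))) 2 → ℂ,
            xxzHamiltonian 1 (torusGraph d (2 * (j + 1))) (-1) 0 *ᵥ Φ₀ =
              ((xxzHamiltonian 1 (torusGraph d (2 * (j + 1))) (-1) 0).groundEnergy : ℂ) • Φ₀ → star Φ₀ ⬝ᵥ Ψ = 0) ∧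
          E - (xxzHamiltonian 1 (torusGraph d (2 * (j + 1))) (-1) 0).groundEnergy ≤
            c₃ * (M : ℝ) ^ 2 / Fintype.card (TorusSite d (2 * (j + 1))) :=
  hardCoreBoson_andersonTower_eigenstates KomaTasaki.theorem_2_4_holds hd

end XXZKT

end Literature.MathematicalPhysics.QuantumLattice
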